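import Summits.BirchSwinnertonDyer.BirchSwinnertonDyer.Theorems.SignedLowerHalvesKobayashiLowerHalfLargeImageCongruencePlaces
import HarnessLib

/-!
# Route `SignedLowerHalves`, crux `KobayashiLowerHalfLargeImage` (item stmt-BirchSwinnertonDyer-19001):
# the congruence road's PLACE TOOLKIT, one more case — a GOOD prime `ℓ` of `Σ₀` with `p ∤ #Ẽ(𝔽_ℓ)` has
# `δ^{(ℓ)} = 0` (cell `bsd-ssimc`, seat `bsd-ssimc-k3-c3` gen 9, object «X7-RESIDUE-ROADS»; a `--supports
# stmt-BirchSwinnertonDyer-19001 --as helper` file; closes nothing)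

PARTITION (cell bsd-ssimc): X7 (A7) × item 3's rank-one window on the RANK-DONOR congruence road — the kernel
bookkeeping case the donor records at scale need (MEMO-9 §N(3)(o)): when the partner `E′` is bad at a prime `ℓ`
where `E` is good (or vice versa), `ℓ ∈ Σ₀` and the good curve's local term is Greenberg–Vatsal's `s_ℓ · d_ℓ` with
`d_ℓ` = the multiplicity of the eigenvalue `1` of `Frob_ℓ` on `E[p]`; `…CongruencePlaces.lean` (p467415) evaluates it
when `p ∣ #Ẽ(𝔽_ℓ)` (`delta_eq_of_good_of_dvd_count`); this file adds the complementary case `p ∤ #Ẽ(𝔽_ℓ)` ⇒ `δ = 0`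
(`X2/LocalDeltaCalculus.dMultiplicity_eq_zero_iff_of_hasGoodReductionAt`). THEOREMS ONLY: no definition, no
named fact, nothing about any curve asserted; BSD is not proved by any of this.

References: [GreenbergVatsal2000] §2 Prop. (2.4) (p. 22), p. 27; [SilvermanAEC2009] VII.5 Prop. 5.1.
-/

set_option autoImplicit false
set_option linter.dupNamespace false
noncomputable section

open scoped Classical

open WeierstrassCurve NumberField IsDedekindDomain Rat.HeightOneSpectrum
  Literature.NumberTheory.EllipticCurves
  Literature.NumberTheory.EllipticCurves.Rank1Residual
  Literature.NumberTheory.EllipticCurves.GreenbergVatsal2000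
  Literature.NumberTheory.EllipticCurves.Rank1Residual.X11RankOneCertificates
  Summit.BirchSwinnertonDyer.Rank1Residual.Supersingular
  Summit.BirchSwinnertonDyer.Rank1Residual.X2.LocalDeltaCalculus
  Summit.BirchSwinnertonDyer.BirchSwinnertonDyer.Rank1Residual.IntModel
  Summit.BirchSwinnertonDyer.BirchSwinnertonDyer.Rank1Residual.X11RankOne

namespace Summit.BirchSwinnertonDyer.BirchSwinnertonDyer.Theorems.CongruenceRoad

variable {W : WeierstrassCurve ℚ} [W.IsElliptic] [W.IsGloballyMinimal] {E₀ : WeierstrassCurve ℤ}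
  (hI : integralModelInt W = E₀)

include hI in
/-- **Good at the place over `ℓ ∤ 2pΔ` with `p ∤ #Ẽ(𝔽_ℓ)`** (point count by `countPoints`) ⇒ `δ = 0`: the
eigenvalue `1` does not occur for `Frob_ℓ` on `E[p]` (`a_ℓ ≢ ℓ + 1 (mod p)`), so `d_ℓ = 0`.
[cite: GreenbergVatsal2000, §2 Prop. (2.4) and p. 27] -/
theorem delta_eq_zero_of_good_of_not_dvd_count (p : ℕ) [hp : Fact p.Prime] (v : HeightOneSpectrum (𝓞 ℚ))
    (ℓ : ℕ) (hℓ : ℓ.Prime) (hvℓ : natGenerator v = ℓ) (hℓ2 : ℓ ≠ 2) (hℓp : ℓ ≠ p) {a1 a2 a3 a4 a6 : ℤ}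
    (hE₀ : E₀ = ⟨a1, a2, a3, a4, a6⟩) (hΔ : ¬ (ℓ : ℤ) ∣ discOf [a1, a2, a3, a4, a6]) {n : ℕ}
    (hc : countPoints [a1, a2, a3, a4, a6] ℓ = n) (hpn : ¬ (p : ℤ) ∣ (n : ℤ)) :
    delta W p v = 0 := by
  subst hvℓ hE₀
  haveI := Fact.mk (primesEquiv v).2
  have hΔ' : ¬ ((natGenerator v : ℕ) : ℤ) ∣ (⟨a1, a2, a3, a4, a6⟩ : WeierstrassCurve ℤ).Δ := by
    rw [intCurve_Δ]; exact hΔ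
  have hgood : W.HasGoodReductionAt v := hasGoodReductionAt_of_not_dvd hI v hΔ'
  have hcard := natCard_point_eq_of_countPoints a1 a2 a3 a4 a6 (natGenerator v) hℓ2 hΔ hc
  have htr : W.frobeniusTraceAt v = ((natGenerator v : ℕ) : ℤ) + 1 - n := by
    rw [frobeniusTraceAt_eq_frobeniusTrace]
    change W.frobeniusTrace (natGenerator v) = _
    rw [frobeniusTrace_eq hI hcard]
  have hndvd : ¬ (p : ℤ) ∣ ((natGenerator v : ℕ) + 1 - W.frobeniusTraceAt v : ℤ) := by
    rw [htr]; ring_nf; exact hpn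
  rw [delta_eq, (dMultiplicity_eq_zero_iff_of_hasGoodReductionAt hgood hℓp).mpr hndvd, mul_zero]

end Summit.BirchSwinnertonDyer.BirchSwinnertonDyer.Theorems.CongruenceRoad

end
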